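import Summits.BirchSwinnertonDyer.Rank1Residual.X11b.Three.TorsionNegOneLift
import Literature.NumberTheory.EllipticCurves.GaloisAction
import HarnessLib

/-!
# X11b at `p = 3` (team N8/O2, LEAD DEAL #3 p7 item; consumers team n1011 T-a3, LINE-K K4(a)):
# surjectivity of `ρ̄_{E,3}` alone gives `H¹(F(E[3^m])/F, E[3^m]) = 0` and `E[3^m]^{Γ_F} = 0` for
# EVERY `m ≥ 1` — the Galois glue of `Three/TorsionNegOneLift.lean` (cell `b2b-bsdres`, team `x11b3`)

HONEST FRAMING (verbatim, cell `b2b-bsdres`, run/shared/lean/b2b/bsd-rank1-residual/): the goal of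
the cell is to DELETE the COMBINATION-SHAPED residual classes for ALL analytic-rank `≤ 1` curves
over `ℚ` — "full BSD formula for every rank `≤ 1` curve in class `C`" assembled STRICTLY from
published theorems — so that the rank-`≤ 1` remainder becomes exactly the CONSTRUCTION-SHAPED
classes, which are TYPED (missing-input Props), NOT attempted; this is not "finishing BSD".
Research route (team N8/O2: STEP L at `3 ‖ N`); ELEMENTARY Galois-module algebra; nothing booked; no
label touched; X11b@3 stays OPEN (RESIDUAL-MAP §I O2). THEOREMS ONLY; no definition; no named fact;
no `sorry`.

## What this file does (n1011 lead R3-20: "the `Surj W 3 → ∀ m, H¹ = 0` consumer is x11b3-p7's")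

For a Weierstrass curve `W` over a field `F`, the tree's mod-`n` representation is
`W.galoisRepTorsion n : Γ_F →* Aut(E[n])` (`GaloisAction.lean`; `E[n] = W.geomTorsion n ⊆ E(F̄)`,
`Aut = Multiplicative (AddAut _)`), and `W.HasSurjectiveModNGaloisRep n` is its surjectivity. The
IMAGE `(W.galoisRepTorsion n).range` is the Galois group `Gal(F(E[n])/F)` realised inside `Aut(E[n])`.

* §1 `WeierstrassCurve.exists_smul_eq_neg_of_surj` — `ρ̄_{E,3}` onto ⟹ some `γ₀ ∈ Γ_F` acts as
  `−1` on `E[3]`; `…_geomTorsion_pow` — the same `γ₀` acts as `−1` on the `3`-torsion of `E[3^m]`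
  (`E[3] ⊆ E[3^m]`, same action); `nsmul_eq_zero_geomTorsion_pow` — `3^m · E[3^m] = 0`.
* §2 `WeierstrassCurve.smul_eq_neg_on_geomTorsion_pow_of_surj` — hence `γ₀^{3^{m−1}}` acts as `−1`
  on `E[3^m]` for every `m ≥ 1` (the basis-free lift `TorsionNegOneLift` §2; cf. Lawson–Wuthrich
  2016 Lemma 3 / p1's matrix `ImageNegOneLift`): **`−1 ∈ ρ_{E,3^m}(Γ_F)` from `Surj W 3` alone**
  (`neg_mem_range_galoisRepTorsion_of_surj`).
* §3 THE CONSUMER SHAPE: `WeierstrassCurve.galoisImage_crossedHom_principal_of_surj_three` — for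
  `m ≥ 1`, every crossed homomorphism `f : Gal → E[3^m]` of `Gal = (W.galoisRepTorsion (3^m)).range`
  (`f(gh) = g(f h) + f g`) is principal, i.e. **`H¹(F(E[3^m])/F, E[3^m]) = 0`**; and
  `WeierstrassCurve.geomTorsion_pow_eq_zero_of_forall_smul_eq_of_surj_three` — **`E[3^m]^{Γ_F} = 0`**
  (no non-zero `F`-rational-as-Galois-fixed `3`-power torsion). Both from `Surj W 3` ONLY — no tower
  surjectivity, no `F ≠ ℚ(√−3)`, any field `F` (the consumers: team n1011 T-a3's (H.3)-type input
  "LW16 Lemma 3 at every level", LINE-K K4 (a), McCallum §3 (2)–(3)-type restriction steps).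

What this is NOT: no statement about division FIELDS as subfields of `F̄` (the tree realises
`Gal(F(E[n])/F)` as the image in `Aut(E[n])`, which is what the consumers quantify over); no claim
about any particular curve; nothing booked.

References: C.-H. Sah, J. Algebra 10 (1968) Prop. 2.7 (b) [Sah1968]; T. Lawson, C. Wuthrich,
Springer PROMS 188 (2016) Lemma 3 [LawsonWuthrich2016]; J.-P. Serre, Invent. Math. 15 (1972) §4
[Serre1972]; team files `cells/x11b3/PLAN.md` §2 S7, `cells/x11b3/LINE-K.md` K4(a), LEAD DEAL #3.
-/

namespace WeierstrassCurve

open Summit.BirchSwinnertonDyer.Rank1Residual.X11b.Three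

universe u

variable {F : Type u} [Field F] (W : WeierstrassCurve F)

/-! ### §1. From `ρ̄_{E,3}` onto: an element of `Γ_F` acting as `−1` on `E[3]`, and on `E[3^m][3]` -/

/-- **Surjectivity of `ρ̄_{E,n}` supplies an element acting as `−1` on `E[n]`** (negation is an
automorphism of the abelian group `E[n]`). [folklore] -/
theorem exists_smul_eq_neg_of_surj {n : ℤ} (hsurj : W.HasSurjectiveModNGaloisRep n) :
    ∃ γ₀ : Field.absoluteGaloisGroup F, ∀ P : W.geomTorsion n, γ₀ • P = -P := by
  obtain ⟨γ₀, hγ₀⟩ := hsurj (Multiplicative.ofAdd (AddEquiv.neg (W.geomTorsion n)))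
  refine ⟨γ₀, fun P ↦ ?_⟩
  rw [← galoisRepTorsion_apply, hγ₀]
  rfl

/-- `E[3^m]` is killed by `3^m` (as natural-number multiples of its elements). [folklore] -/
theorem nsmul_eq_zero_geomTorsion_pow (m : ℕ) (x : W.geomTorsion ((3 ^ m : ℕ) : ℤ)) :
    (3 : ℕ) ^ m • x = 0 :=
  AddSubgroup.torsionBy.nsmul x

/-- An element of `Γ_F` acting as `−1` on `E[3]` acts as `−1` on the `3`-torsion of `E[3^m]`
(`E[3] ⊆ E[3^m] ⊆ E(F̄)` with one and the same action of `Γ_F`). [folklore] -/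
theorem smul_eq_neg_geomTorsion_pow_of_three_nsmul {γ₀ : Field.absoluteGaloisGroup F}
    (hγ₀ : ∀ P : W.geomTorsion 3, γ₀ • P = -P) (m : ℕ) (x : W.geomTorsion ((3 ^ m : ℕ) : ℤ))
    (hx : (3 : ℕ) • x = 0) : γ₀ • x = -x := by
  -- the underlying geometric point of `x` is `3`-torsion
  have hx3 : (x : W.geomPoints) ∈ W.geomTorsion 3 := by
    have h := congrArg Subtype.val hx
    rw [AddSubgroupClass.coe_nsmul, ZeroMemClass.coe_zero] at h
    exact (Submodule.mem_torsionBy_iff (3 : ℤ) _).mpr (by rw [ofNat_zsmul]; exact h)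
  have h := congrArg Subtype.val (hγ₀ ⟨(x : W.geomPoints), hx3⟩)
  rw [Literature.NumberTheory.EllipticCurves.AddSubgroup.torsionBy.coe_smul,
    AddSubgroup.coe_neg] at h
  apply Subtype.ext
  rw [Literature.NumberTheory.EllipticCurves.AddSubgroup.torsionBy.coe_smul, AddSubgroup.coe_neg]
  exact h

/-! ### §2. The lift: `−1 ∈ ρ_{E,3^m}(Γ_F)` from `ρ̄_{E,3}` onto -/

/-- **`Surj W 3 ⟹` some element of `Γ_F` acts as `−1` on `E[3^m]`, every `m ≥ 1`** (with `γ₀` acting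
as `−1` on `E[3]`, `γ₀^{3^{m−1}}` does — `TorsionNegOneLift` §2, basis-free; cf. Lawson–Wuthrich
Lemma 3, p1's matrix `ImageNegOneLift`). [cite: LawsonWuthrich2016, Lemma 3] -/
theorem smul_eq_neg_on_geomTorsion_pow_of_surj (hsurj : W.HasSurjectiveModNGaloisRep 3) {m : ℕ}
    (hm : 1 ≤ m) :
    ∃ γ : Field.absoluteGaloisGroup F, ∀ x : W.geomTorsion ((3 ^ m : ℕ) : ℤ), γ • x = -x := by
  obtain ⟨γ₀, hγ₀⟩ := W.exists_smul_eq_neg_of_surj hsurj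
  exact ⟨γ₀ ^ 3 ^ (m - 1), smul_pow_three_pow_eq_neg hm (W.nsmul_eq_zero_geomTorsion_pow m)
    (fun x hx ↦ W.smul_eq_neg_geomTorsion_pow_of_three_nsmul hγ₀ m x hx)⟩

/-- **`−1 ∈ ρ_{E,3^m}(Γ_F)` from `ρ̄_{E,3}` onto**: the negation automorphism of `E[3^m]` lies in the
image of `galoisRepTorsion W (3^m)`, for every `m ≥ 1`. [cite: LawsonWuthrich2016, Lemma 3] -/
theorem neg_mem_range_galoisRepTorsion_of_surj (hsurj : W.HasSurjectiveModNGaloisRep 3) {m : ℕ}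
    (hm : 1 ≤ m) :
    Multiplicative.ofAdd (AddEquiv.neg (W.geomTorsion ((3 ^ m : ℕ) : ℤ))) ∈
      (W.galoisRepTorsion ((3 ^ m : ℕ) : ℤ)).range := by
  obtain ⟨γ, hγ⟩ := W.smul_eq_neg_on_geomTorsion_pow_of_surj hsurj hm
  refine ⟨γ, ?_⟩
  apply Multiplicative.toAdd.injective
  apply AddEquiv.ext
  intro x
  rw [galoisRepTorsion_apply, hγ]
  rfl

/-! ### §3. THE CONSUMER SHAPE: `H¹(F(E[3^m])/F, E[3^m]) = 0` and `E[3^m]^{Γ_F} = 0` from `Surj W 3` -/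

/-- **`H¹(Gal(F(E[3^m])/F), E[3^m]) = 0` from `ρ̄_{E,3}` onto, every `m ≥ 1`.** With
`Gal = (W.galoisRepTorsion (3^m)).range ≤ Aut(E[3^m])` (the Galois group of the `3^m`-division field
realised by its faithful action): every crossed homomorphism `f : Gal → E[3^m]`
(`f(gh) = g(f h) + f g`) is principal, `f g = g a − a`. Proof: `Surj W 3` puts an element acting as
`−1` into `Gal` (§2); `−1` is central in `Aut(E[3^m])`; Sah's lemma with `2` invertible on the
`3^m`-torsion group `E[3^m]` (`TorsionNegOneLift` §3). The `p = 3` substitute for "`3 ∤ #Gal`"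
(false: `3 ∣ #GL₂(𝔽₃)`) in the Kolyvagin-system hypotheses (team n1011 T-a3 (H.3); LINE-K K4 (a);
Lawson–Wuthrich Lemma 3 at every level). NO tower surjectivity, no condition on `F`.
[cite: Sah1968, Prop. 2.7 (b) and its proof, p. 60] [cite: LawsonWuthrich2016, Lemma 3] -/
theorem galoisImage_crossedHom_principal_of_surj_three (hsurj : W.HasSurjectiveModNGaloisRep 3)
    {m : ℕ} (hm : 1 ≤ m)
    (f : (W.galoisRepTorsion ((3 ^ m : ℕ) : ℤ)).range → W.geomTorsion ((3 ^ m : ℕ) : ℤ))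
    (hf : ∀ g h : (W.galoisRepTorsion ((3 ^ m : ℕ) : ℤ)).range,
      f (g * h) =
        Multiplicative.toAdd (g : Multiplicative (AddAut (W.geomTorsion ((3 ^ m : ℕ) : ℤ))))
          (f h) + f g) :
    ∃ a : W.geomTorsion ((3 ^ m : ℕ) : ℤ), ∀ g : (W.galoisRepTorsion ((3 ^ m : ℕ) : ℤ)).range,
      f g =
        Multiplicative.toAdd (g : Multiplicative (AddAut (W.geomTorsion ((3 ^ m : ℕ) : ℤ)))) a - a :=
  exists_eq_sub_of_crossedHom_of_neg_mem (Odd.pow (by decide) : Odd (3 ^ m))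
    (W.nsmul_eq_zero_geomTorsion_pow m) _ (W.neg_mem_range_galoisRepTorsion_of_surj hsurj hm)
    (fun _ ↦ rfl) f hf

/-- **`E[3^m]^{Γ_F} = 0` from `ρ̄_{E,3}` onto, every `m ≥ 1`**: no non-zero point of `E[3^m]` is fixed
by `Γ_F` (so, for `F` perfect, `E(F)[3^∞] = 0`); also at every layer of a pro-`3` tower by
`Three/ImageSahTower.lean` once images are compared. [folklore] -/
theorem geomTorsion_pow_eq_zero_of_forall_smul_eq_of_surj_three
    (hsurj : W.HasSurjectiveModNGaloisRep 3) {m : ℕ} (hm : 1 ≤ m)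
    {x : W.geomTorsion ((3 ^ m : ℕ) : ℤ)} (hfix : ∀ γ : Field.absoluteGaloisGroup F, γ • x = x) :
    x = 0 := by
  obtain ⟨γ₀, hγ₀⟩ := W.exists_smul_eq_neg_of_surj hsurj
  exact eq_zero_of_forall_smul_eq hm (W.nsmul_eq_zero_geomTorsion_pow m)
    (fun y hy ↦ W.smul_eq_neg_geomTorsion_pow_of_three_nsmul hγ₀ m y hy) hfix

/-! ### §4. The same from ONE element acting as `−1` on `E[3]` (for extensions `F ⊇ K`: team E-K7) -/

/-- **Lift from one element** (no surjectivity): if SOME `γ₀ ∈ Γ_F` acts as `−1` on `E[3]`, then for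
every `m ≥ 1` some element of `Γ_F` (namely `γ₀^{3^{m−1}}`) acts as `−1` on `E[3^m]`. The hypothesis
is what a descent to an extension field `F ⊇ K` supplies (e.g. `−1 ∈ [ρ̄₃(Γ_K), ρ̄₃(Γ_K)] ⊆ ρ̄₃(Γ_F)`
for `F/K` abelian — team LINE-K E-K7), where `ρ̄_{E,3}|_{Γ_F}` need not be onto.
[cite: LawsonWuthrich2016, Lemma 3] -/
theorem smul_eq_neg_on_geomTorsion_pow_of_exists_smul_eq_neg
    (hneg : ∃ γ₀ : Field.absoluteGaloisGroup F, ∀ P : W.geomTorsion 3, γ₀ • P = -P) {m : ℕ}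
    (hm : 1 ≤ m) :
    ∃ γ : Field.absoluteGaloisGroup F, ∀ x : W.geomTorsion ((3 ^ m : ℕ) : ℤ), γ • x = -x := by
  obtain ⟨γ₀, hγ₀⟩ := hneg
  exact ⟨γ₀ ^ 3 ^ (m - 1), smul_pow_three_pow_eq_neg hm (W.nsmul_eq_zero_geomTorsion_pow m)
    (fun x hx ↦ W.smul_eq_neg_geomTorsion_pow_of_three_nsmul hγ₀ m x hx)⟩

/-- **`−1 ∈ ρ_{E,3^m}(Γ_F)` from one element acting as `−1` on `E[3]`**, every `m ≥ 1`.
[cite: LawsonWuthrich2016, Lemma 3] -/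
theorem neg_mem_range_galoisRepTorsion_of_exists_smul_eq_neg
    (hneg : ∃ γ₀ : Field.absoluteGaloisGroup F, ∀ P : W.geomTorsion 3, γ₀ • P = -P) {m : ℕ}
    (hm : 1 ≤ m) :
    Multiplicative.ofAdd (AddEquiv.neg (W.geomTorsion ((3 ^ m : ℕ) : ℤ))) ∈
      (W.galoisRepTorsion ((3 ^ m : ℕ) : ℤ)).range := by
  obtain ⟨γ, hγ⟩ := W.smul_eq_neg_on_geomTorsion_pow_of_exists_smul_eq_neg hneg hm
  refine ⟨γ, ?_⟩
  apply Multiplicative.toAdd.injective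
  apply AddEquiv.ext
  intro x
  rw [galoisRepTorsion_apply, hγ]
  rfl

/-- **`H¹(Gal(F(E[3^m])/F), E[3^m]) = 0` from one element acting as `−1` on `E[3]`**, every `m ≥ 1`
(crossed homomorphisms of `(W.galoisRepTorsion (3^m)).range` principal) — the form for a field `F`
over which `ρ̄_{E,3}` is not onto but still hits `−1` (e.g. ring class fields of `K`, team E-K7).
[cite: Sah1968, Prop. 2.7 (b) and its proof, p. 60] [cite: LawsonWuthrich2016, Lemma 3] -/
theorem galoisImage_crossedHom_principal_of_exists_smul_eq_neg
    (hneg : ∃ γ₀ : Field.absoluteGaloisGroup F, ∀ P : W.geomTorsion 3, γ₀ • P = -P)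
    {m : ℕ} (hm : 1 ≤ m)
    (f : (W.galoisRepTorsion ((3 ^ m : ℕ) : ℤ)).range → W.geomTorsion ((3 ^ m : ℕ) : ℤ))
    (hf : ∀ g h : (W.galoisRepTorsion ((3 ^ m : ℕ) : ℤ)).range,
      f (g * h) =
        Multiplicative.toAdd (g : Multiplicative (AddAut (W.geomTorsion ((3 ^ m : ℕ) : ℤ))))
          (f h) + f g) :
    ∃ a : W.geomTorsion ((3 ^ m : ℕ) : ℤ), ∀ g : (W.galoisRepTorsion ((3 ^ m : ℕ) : ℤ)).range,
      f g =
        Multiplicative.toAdd (g : Multiplicative (AddAut (W.geomTorsion ((3 ^ m : ℕ) : ℤ)))) a - a :=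
  exists_eq_sub_of_crossedHom_of_neg_mem (Odd.pow (by decide) : Odd (3 ^ m))
    (W.nsmul_eq_zero_geomTorsion_pow m) _
    (W.neg_mem_range_galoisRepTorsion_of_exists_smul_eq_neg hneg hm) (fun _ ↦ rfl) f hf

/-- **`E[3^m]^{Γ_F} = 0` from one element acting as `−1` on `E[3]`**, every `m ≥ 1`. [folklore] -/
theorem geomTorsion_pow_eq_zero_of_forall_smul_eq_of_exists_smul_eq_neg
    (hneg : ∃ γ₀ : Field.absoluteGaloisGroup F, ∀ P : W.geomTorsion 3, γ₀ • P = -P) {m : ℕ}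
    (hm : 1 ≤ m) {x : W.geomTorsion ((3 ^ m : ℕ) : ℤ)}
    (hfix : ∀ γ : Field.absoluteGaloisGroup F, γ • x = x) : x = 0 := by
  obtain ⟨γ₀, hγ₀⟩ := hneg
  exact eq_zero_of_forall_smul_eq hm (W.nsmul_eq_zero_geomTorsion_pow m)
    (fun y hy ↦ W.smul_eq_neg_geomTorsion_pow_of_three_nsmul hγ₀ m y hy) hfix

end WeierstrassCurve
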